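import Mathlib
import Literature.RepresentationTheory.FiniteGroups.IsotypicProjector
import Literature.RepresentationTheory.FiniteGroups.CharacterDegrees
import Summits.MatrixMultiplication.MatrixMultiplication.Theorems.LevelGradedCohnUmansLevelOneLinkPermModule

/-!
# Structure of the level-one (frame) space of the tangent group `GL₂(K[ε])`
# (stub `stub_tangentStructure` of line `tangent-cell`,
# crux `LevelGradedCohnUmans.GradedDesignFamily`, item `stmt-MatrixMultiplication-7610`)

`K` a finite field (`q = |K|`), `R = K[ε] = DualNumber K` (`|R| = q²`).  The *frame functions* on
`GL₂(R)` are the `g ↦ ∑_{u ∈ R²} c u (g·u)`.  Ring twin of `stub_frameStructure`: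
**(i)** every `u ∈ R² ∖ {0}` is `t • r`, `t ∈ Rˣ`, `r` one of the `≤ 2q² + q + 1` representatives
`(1, w), (w, 1)` (`w ∈ R`; vectors with a unit coordinate), `(ε, cε)` (`c ∈ K`), `(0, ε)`
(non-zero vectors of `ε R² = ε K²`), so every frame function `∑_u ∑_v c u v • [g·u = v]` is in the
span of the `≤ (2q² + q + 1) q⁴ ≤ 5q⁶` indicators `[g·r = v]` (`[g·0 = v]` is `0` or
`1 = ∑_{v'} [g·r₀ = v']`, and `[g·(t • r) = v] = [g·r = t⁻¹ • v]`); the bookkeeping is done over any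
finite commutative ring.  **(ii)** an irreducible frame character `χ` has `χ(1) ≤ 2q²`: its
representation has a `Stab(a)`-fixed vector (`LevelOneLink.exists_fixed_of_character_eq_sum`), so
its degree is at most the size of a central-scalar cover of the orbit of `a`
(`LevelOneLink.finrank_le_card_of_cover`): `{0}` (`a = 0`), the `≤ q + 1` representatives in `ε R²`
(`a ≠ 0 = a mod ε`; the orbit stays in `ε R²`), the `≤ 2q²` representatives `(1, w), (w, 1)`
(`a mod ε ≠ 0`; the orbit avoids `ε R²`).
-/

-- `Summit.<Summit>.<Problem>` is the tree's mandated summit-side namespace; for this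
-- single-conjunct summit the two coincide, so the file silences `dupNamespace`.
set_option linter.dupNamespace false

noncomputable section

open scoped BigOperators
open Module Literature.RepresentationTheory.FiniteGroups

namespace Summit.MatrixMultiplication.MatrixMultiplication.Theorems.GradedDesignFamily

open Matrix TrivSqZeroExt

/-! ### Frame functions over a finite commutative ring -/

section CommRing

variable {R : Type} [CommRing R]

/-- Scalar matrices act on vectors by scalars. [folklore] -/
theorem tangentStructure_scalar_smul_eq (t : Rˣ) (r : Fin 2 → R) :
    (Matrix.GeneralLinearGroup.scalar (Fin 2) t) • r = (t : R) • r := by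
  rw [Units.smul_def, Matrix.GeneralLinearGroup.coe_scalar, Matrix.smul_eq_mulVec,
    Matrix.scalar_apply]
  funext i
  rw [Matrix.mulVec_diagonal, Pi.smul_apply, smul_eq_mul]

/-- Scalar matrices are central in `GL₂(R)`. [folklore] -/
theorem tangentStructure_scalar_mem_center (t : Rˣ) :
    Matrix.GeneralLinearGroup.scalar (Fin 2) t ∈
      Submonoid.center (Matrix.GeneralLinearGroup (Fin 2) R) :=
  Submonoid.mem_center_iff.2 fun g => (Matrix.GeneralLinearGroup.scalar_commute t g).symm

variable [Fintype R] [DecidableEq R]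

/-- Every indicator `[g·u = v]` lies in a submodule `S` containing the indicators at a non-empty
set `Reps` of representatives of the unit orbits on `R² ∖ {0}`: for `u = 0` it is `0` or the
constant `1 = ∑_{v'} [g·r₀ = v']`; for `u = t • r` (`r ∈ Reps`, `t ∈ Rˣ`) it is `[g·r = t⁻¹ • v]`.
[folklore] -/
theorem tangentStructure_ind_mem {S : Submodule ℂ (Matrix.GeneralLinearGroup (Fin 2) R → ℂ)}
    {Reps : Finset (Fin 2 → R)} (hne : Reps.Nonempty)
    (hcov : ∀ u : Fin 2 → R, u ≠ 0 → ∃ r ∈ Reps, ∃ t : R, IsUnit t ∧ t • r = u)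
    (hS : ∀ r ∈ Reps, ∀ v : Fin 2 → R, (fun g : Matrix.GeneralLinearGroup (Fin 2) R =>
      if (g : Matrix (Fin 2) (Fin 2) R).mulVec r = v then (1 : ℂ) else 0) ∈ S)
    (u v : Fin 2 → R) :
    (fun g : Matrix.GeneralLinearGroup (Fin 2) R =>
      if (g : Matrix (Fin 2) (Fin 2) R).mulVec u = v then (1 : ℂ) else 0) ∈ S := by
  by_cases hu : u = 0
  · subst hu
    by_cases hv : v = 0
    · subst hv
      obtain ⟨r₀, hr₀⟩ := hne
      have h : (fun g : Matrix.GeneralLinearGroup (Fin 2) R =>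
          if (g : Matrix (Fin 2) (Fin 2) R).mulVec (0 : Fin 2 → R) = 0 then (1 : ℂ) else 0) =
          ∑ v : Fin 2 → R, fun g : Matrix.GeneralLinearGroup (Fin 2) R =>
            if (g : Matrix (Fin 2) (Fin 2) R).mulVec r₀ = v then (1 : ℂ) else 0 := by
        funext g
        rw [Matrix.mulVec_zero, if_pos rfl, Finset.sum_apply, Finset.sum_ite_eq,
          if_pos (Finset.mem_univ _)]
      rw [h]
      exact Submodule.sum_mem _ fun v _ => hS r₀ hr₀ v
    · have h : (fun g : Matrix.GeneralLinearGroup (Fin 2) R =>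
          if (g : Matrix (Fin 2) (Fin 2) R).mulVec (0 : Fin 2 → R) = v then (1 : ℂ) else 0) =
          0 := by
        funext g
        rw [Matrix.mulVec_zero, if_neg (Ne.symm hv), Pi.zero_apply]
      rw [h]
      exact Submodule.zero_mem _
  · obtain ⟨r, hr, t, ⟨t, rfl⟩, rfl⟩ := hcov u hu
    have h : (fun g : Matrix.GeneralLinearGroup (Fin 2) R =>
        if (g : Matrix (Fin 2) (Fin 2) R).mulVec ((t : R) • r) = v then (1 : ℂ) else 0) =
        fun g : Matrix.GeneralLinearGroup (Fin 2) R =>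
          if (g : Matrix (Fin 2) (Fin 2) R).mulVec r = (t⁻¹ : Rˣ) • v then (1 : ℂ) else 0 := by
      funext g
      rw [Matrix.mulVec_smul, ← Units.smul_def]
      exact if_congr (smul_eq_iff_eq_inv_smul t) rfl rfl
    rw [h]
    exact hS r hr _

/-- **Frame functions as combinations of indicators**:
`∑_u c u (g·u) = ∑_u ∑_v c u v • [g·u = v]`. [folklore] -/
theorem tangentStructure_frameFn_eq (c : (Fin 2 → R) → (Fin 2 → R) → ℂ) :
    (fun g : Matrix.GeneralLinearGroup (Fin 2) R =>
        ∑ u : Fin 2 → R, c u ((g : Matrix (Fin 2) (Fin 2) R).mulVec u)) =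
      ∑ u : Fin 2 → R, ∑ v : Fin 2 → R, c u v • fun g : Matrix.GeneralLinearGroup (Fin 2) R =>
        if (g : Matrix (Fin 2) (Fin 2) R).mulVec u = v then (1 : ℂ) else 0 := by
  funext g
  rw [Finset.sum_apply]
  refine Finset.sum_congr rfl fun u _ => ?_
  rw [Finset.sum_apply]
  simp only [Pi.smul_apply, smul_eq_mul, mul_ite, mul_one, mul_zero]
  rw [Finset.sum_ite_eq, if_pos (Finset.mem_univ _)]

/-- **(i), abstract form**: if a non-empty `Reps` covers `R² ∖ {0}` by units, the `|Reps| · |R²|`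
indicators `[g·r = v]` (`r ∈ Reps`, `v ∈ R²`) span all frame functions. [folklore] -/
theorem tangentStructure_exists_spanning_of_cover {Reps : Finset (Fin 2 → R)}
    (hne : Reps.Nonempty)
    (hcov : ∀ u : Fin 2 → R, u ≠ 0 → ∃ r ∈ Reps, ∃ t : R, IsUnit t ∧ t • r = u) :
    ∃ B : Finset (Matrix.GeneralLinearGroup (Fin 2) R → ℂ),
      B.card ≤ Reps.card * Fintype.card (Fin 2 → R) ∧
      ∀ c : (Fin 2 → R) → (Fin 2 → R) → ℂ,
        (fun g : Matrix.GeneralLinearGroup (Fin 2) R =>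
            ∑ u : Fin 2 → R, c u ((g : Matrix (Fin 2) (Fin 2) R).mulVec u)) ∈
          Submodule.span ℂ (B : Set (Matrix.GeneralLinearGroup (Fin 2) R → ℂ)) := by
  refine ⟨(Reps ×ˢ (Finset.univ : Finset (Fin 2 → R))).image
    fun rv => fun g : Matrix.GeneralLinearGroup (Fin 2) R =>
      if (g : Matrix (Fin 2) (Fin 2) R).mulVec rv.1 = rv.2 then (1 : ℂ) else 0, ?_, fun c => ?_⟩
  · refine Finset.card_image_le.trans ?_
    rw [Finset.card_product, Finset.card_univ]
  · rw [tangentStructure_frameFn_eq]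
    refine Submodule.sum_mem _ fun u _ => Submodule.sum_mem _ fun v _ => Submodule.smul_mem _ _
      (tangentStructure_ind_mem hne hcov (fun r hr v => ?_) u v)
    exact Submodule.subset_span (Finset.mem_coe.2 (Finset.mem_image_of_mem _
      (Finset.mk_mem_product hr (Finset.mem_univ v))))

end CommRing

/-! ### Dual numbers: unit-orbit representatives, spanning set, orbit covers, degrees -/

section DualNumber

/-- `|K[ε]| = |K|²` (for any `Fintype` structure on `K[ε]`). [folklore] -/
theorem tangentStructure_card_dualNumber (K : Type) [Fintype K] [Fintype (DualNumber K)] :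
    Fintype.card (DualNumber K) = Fintype.card K ^ 2 := by
  rw [Fintype.card_congr (α := DualNumber K) (β := K × K) (Equiv.refl _), Fintype.card_prod, sq]

variable {K : Type} [Field K]

/-- A dual number with vanishing `K`-part is `ε` times its `ε`-part. [folklore] -/
theorem tangentStructure_eq_inr {x : DualNumber K} (hx : x.fst = 0) : x = inr x.snd :=
  TrivSqZeroExt.ext (by rw [fst_inr, hx]) (by rw [snd_inr])

omit [Field K] in
/-- A vector of length two is determined by its two coordinates. [folklore] -/
theorem tangentStructure_vec2_eq {a b : K} {u : Fin 2 → K} (h0 : a = u 0) (h1 : b = u 1) :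
    ![a, b] = u := by
  funext i
  fin_cases i
  exacts [h0, h1]

/-- `GL₂(K[ε])` preserves the submodule `ε K[ε]²` of vectors reducing to `0 mod ε`. [folklore] -/
theorem tangentStructure_fst_smul_eq_zero (g : Matrix.GeneralLinearGroup (Fin 2) (DualNumber K))
    {u : Fin 2 → DualNumber K} (hu : ∀ i, (u i).fst = 0) (i : Fin 2) : ((g • u) i).fst = 0 := by
  rw [Units.smul_def, Matrix.smul_eq_mulVec]
  change (∑ j, (g : Matrix (Fin 2) (Fin 2) (DualNumber K)) i j * u j).fst = 0
  rw [fst_sum]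
  exact Finset.sum_eq_zero fun j _ => by rw [fst_mul, hu j, mul_zero]

variable [Fintype (DualNumber K)] [DecidableEq (DualNumber K)]

/-- **Unit-orbit representatives, vectors with a unit coordinate**: such a vector of `K[ε]²` is
a unit multiple of some `(1, w)` or `(w, 1)` (`w ∈ K[ε]`). [folklore] -/
theorem tangentStructure_exists_smul_eq_of_fst_ne {u : Fin 2 → DualNumber K}
    (hu : ∃ i, (u i).fst ≠ 0) :
    ∃ r ∈ (Finset.univ.image fun w : DualNumber K => (![1, w] : Fin 2 → DualNumber K)) ∪
        (Finset.univ.image fun w : DualNumber K => (![w, 1] : Fin 2 → DualNumber K)),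
      ∃ t : DualNumber K, IsUnit t ∧ t • r = u := by
  by_cases h0 : (u 0).fst = 0
  · have h1 : (u 1).fst ≠ 0 := by
      obtain ⟨i, hi⟩ := hu
      fin_cases i
      · exact absurd h0 hi
      · exact hi
    refine ⟨![(u 1)⁻¹ * u 0, 1],
      Finset.mem_union_right _ (Finset.mem_image_of_mem _ (Finset.mem_univ _)), u 1,
      isUnit_iff_isUnit_fst.2 (isUnit_iff_ne_zero.2 h1), ?_⟩
    rw [Matrix.smul_vec2, smul_eq_mul, smul_eq_mul, ← mul_assoc, TrivSqZeroExt.mul_inv_cancel h1,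
      one_mul, mul_one]
    exact tangentStructure_vec2_eq rfl rfl
  · refine ⟨![1, (u 0)⁻¹ * u 1],
      Finset.mem_union_left _ (Finset.mem_image_of_mem _ (Finset.mem_univ _)), u 0,
      isUnit_iff_isUnit_fst.2 (isUnit_iff_ne_zero.2 h0), ?_⟩
    rw [Matrix.smul_vec2, smul_eq_mul, smul_eq_mul, mul_one, ← mul_assoc,
      TrivSqZeroExt.mul_inv_cancel h0, one_mul]
    exact tangentStructure_vec2_eq rfl rfl

omit [Fintype (DualNumber K)] in
/-- **Unit-orbit representatives, vectors in `ε K[ε]²`**: a non-zero vector of `K[ε]²` reducing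
to `0 mod ε` is a unit multiple of some `(ε, cε)` (`c ∈ K`) or of `(0, ε)`. [folklore] -/
theorem tangentStructure_exists_smul_eq_of_fst_eq [Fintype K] {u : Fin 2 → DualNumber K}
    (hu : u ≠ 0) (hu' : ∀ i, (u i).fst = 0) :
    ∃ r ∈ insert (![0, inr 1] : Fin 2 → DualNumber K)
        (Finset.univ.image fun c : K => (![inr 1, inr c] : Fin 2 → DualNumber K)),
      ∃ t : DualNumber K, IsUnit t ∧ t • r = u := by
  by_cases h0 : (u 0).snd = 0
  · have hu0 : u 0 = 0 := TrivSqZeroExt.ext (hu' 0) h0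
    have h1 : (u 1).snd ≠ 0 := by
      intro h1
      apply hu
      funext i
      fin_cases i
      · exact hu0
      · exact TrivSqZeroExt.ext (hu' 1) h1
    refine ⟨![0, inr 1], Finset.mem_insert_self _ _, inl (u 1).snd,
      isUnit_inl_iff.2 (isUnit_iff_ne_zero.2 h1), ?_⟩
    rw [Matrix.smul_vec2, smul_zero, smul_eq_mul, inl_mul_inr, smul_eq_mul, mul_one]
    exact tangentStructure_vec2_eq hu0.symm (tangentStructure_eq_inr (hu' 1)).symm
  · refine ⟨![inr 1, inr (((u 0).snd)⁻¹ * (u 1).snd)],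
      Finset.mem_insert_of_mem (Finset.mem_image_of_mem _ (Finset.mem_univ _)), inl (u 0).snd,
      isUnit_inl_iff.2 (isUnit_iff_ne_zero.2 h0), ?_⟩
    rw [Matrix.smul_vec2, smul_eq_mul, smul_eq_mul, inl_mul_inr, inl_mul_inr, smul_eq_mul,
      smul_eq_mul, mul_one, ← mul_assoc, mul_inv_cancel₀ h0, one_mul]
    exact tangentStructure_vec2_eq (tangentStructure_eq_inr (hu' 0)).symm
      (tangentStructure_eq_inr (hu' 1)).symm

variable [Fintype K]

variable (K) in
/-- The representatives `(1, w), (w, 1)` (`w ∈ K[ε]`) are at most `2|K|²` in number.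
[folklore] -/
theorem tangentStructure_card_repsA_le :
    ((Finset.univ.image fun w : DualNumber K => (![1, w] : Fin 2 → DualNumber K)) ∪
        (Finset.univ.image fun w : DualNumber K => (![w, 1] : Fin 2 → DualNumber K))).card ≤
      2 * Fintype.card K ^ 2 := by
  refine (Finset.card_union_le _ _).trans ?_
  have h1 := Finset.card_image_le (s := (Finset.univ : Finset (DualNumber K)))
    (f := fun w : DualNumber K => (![1, w] : Fin 2 → DualNumber K))
  have h2 := Finset.card_image_le (s := (Finset.univ : Finset (DualNumber K)))
    (f := fun w : DualNumber K => (![w, 1] : Fin 2 → DualNumber K))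
  rw [Finset.card_univ, tangentStructure_card_dualNumber] at h1 h2
  omega

omit [Fintype (DualNumber K)] in
variable (K) in
/-- The representatives `(ε, cε)` (`c ∈ K`), `(0, ε)` are at most `|K| + 1` in number.
[folklore] -/
theorem tangentStructure_card_repsB_le :
    (insert (![0, inr 1] : Fin 2 → DualNumber K)
        (Finset.univ.image fun c : K => (![inr 1, inr c] : Fin 2 → DualNumber K))).card ≤
      Fintype.card K + 1 := by
  refine (Finset.card_insert_le _ _).trans ?_
  have h := Finset.card_image_le (s := (Finset.univ : Finset K))
    (f := fun c : K => (![inr 1, inr c] : Fin 2 → DualNumber K))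
  rw [Finset.card_univ] at h
  omega

variable (K) in
/-- **(i), assembled**: the `≤ (2q² + q + 1) q⁴ ≤ 5q⁶` indicators `[g·r = v]` (`r` a unit-orbit
representative, `v ∈ K[ε]²`) span all frame functions on `GL₂(K[ε])`. [folklore] -/
theorem tangentStructure_exists_spanning :
    ∃ B : Finset (Matrix.GeneralLinearGroup (Fin 2) (DualNumber K) → ℂ),
      B.card ≤ 5 * Fintype.card K ^ 6 ∧
      ∀ c : (Fin 2 → DualNumber K) → (Fin 2 → DualNumber K) → ℂ,
        (fun g : Matrix.GeneralLinearGroup (Fin 2) (DualNumber K) =>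
            ∑ u : Fin 2 → DualNumber K,
              c u ((g : Matrix (Fin 2) (Fin 2) (DualNumber K)).mulVec u)) ∈
          Submodule.span ℂ (B : Set (Matrix.GeneralLinearGroup (Fin 2) (DualNumber K) → ℂ)) := by
  -- every `u ≠ 0` is a unit multiple of a representative `(1, w), (w, 1), (ε, cε), (0, ε)`
  obtain ⟨B, hB, hspan⟩ := tangentStructure_exists_spanning_of_cover
    (Finset.Nonempty.inr (Finset.insert_nonempty (![0, inr 1] : Fin 2 → DualNumber K)
      (Finset.univ.image fun c : K => (![inr 1, inr c] : Fin 2 → DualNumber K))))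
    fun u hu => by
      by_cases h : ∃ i, (u i).fst ≠ 0
      · obtain ⟨r, hr, t, ht, rfl⟩ := tangentStructure_exists_smul_eq_of_fst_ne h
        exact ⟨r, Finset.mem_union_left _ hr, t, ht, rfl⟩
      · push Not at h
        obtain ⟨r, hr, t, ht, rfl⟩ := tangentStructure_exists_smul_eq_of_fst_eq hu h
        exact ⟨r, Finset.mem_union_right _ hr, t, ht, rfl⟩
  refine ⟨B, hB.trans ?_, hspan⟩
  have hq : 0 < Fintype.card K := Fintype.card_pos
  have h4 : Fintype.card K ^ 4 ≤ Fintype.card K ^ 6 := Nat.pow_le_pow_right hq (by norm_num)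
  have h5 : Fintype.card K ^ 5 ≤ Fintype.card K ^ 6 := Nat.pow_le_pow_right hq (by norm_num)
  rw [Fintype.card_fun, Fintype.card_fin, tangentStructure_card_dualNumber]
  calc _ ≤ (2 * Fintype.card K ^ 2 + (Fintype.card K + 1)) * (Fintype.card K ^ 2) ^ 2 :=
        Nat.mul_le_mul_right _ ((Finset.card_union_le _ _).trans (Nat.add_le_add
          (tangentStructure_card_repsA_le K) (tangentStructure_card_repsB_le K)))
    _ = 2 * Fintype.card K ^ 6 + Fintype.card K ^ 5 + Fintype.card K ^ 4 := by ring
    _ ≤ 5 * Fintype.card K ^ 6 := by omega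

/-- **Orbit cover in `K[ε]²`**: the `GL₂(K[ε])`-orbit of `a ∈ K[ε]²` is covered, via central
scalar matrices, by `≤ 2|K|²` vectors: `{0}` if `a = 0`; the representatives `(1, w), (w, 1)` if
`a mod ε ≠ 0` (the orbit avoids `ε K[ε]²`); `(ε, cε), (0, ε)` if `a ≠ 0 = a mod ε` (the orbit
stays in `ε K[ε]² ∖ {0}`). [folklore] -/
theorem tangentStructure_exists_cover (a : Fin 2 → DualNumber K) :
    ∃ R : Finset (Fin 2 → DualNumber K), R.card ≤ 2 * Fintype.card K ^ 2 ∧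
      ∀ u : Fin 2 → DualNumber K,
        (∀ g : Matrix.GeneralLinearGroup (Fin 2) (DualNumber K), g • a ≠ u) ∨
        ∃ r ∈ R, ∃ z : Matrix.GeneralLinearGroup (Fin 2) (DualNumber K),
          z ∈ Submonoid.center (Matrix.GeneralLinearGroup (Fin 2) (DualNumber K)) ∧
            z • r = u := by
  have hq : 0 < Fintype.card K := Fintype.card_pos
  have hq2 : 0 < Fintype.card K ^ 2 := Nat.pow_pos hq
  by_cases ha : a = 0
  · refine ⟨{0}, by rw [Finset.card_singleton]; omega, fun u => ?_⟩
    by_cases hu : u = 0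
    · exact Or.inr ⟨0, Finset.mem_singleton_self _, 1, Submonoid.one_mem _, by rw [one_smul, hu]⟩
    · refine Or.inl fun g hg => hu ?_
      rw [← hg, ha, Units.smul_def, Matrix.smul_eq_mulVec, Matrix.mulVec_zero]
  by_cases ha' : ∃ i, (a i).fst ≠ 0
  · refine ⟨_, tangentStructure_card_repsA_le K, fun u => ?_⟩
    by_cases hu' : ∃ i, (u i).fst ≠ 0
    · obtain ⟨r, hr, t, ⟨t, rfl⟩, rfl⟩ := tangentStructure_exists_smul_eq_of_fst_ne hu'
      exact Or.inr ⟨r, hr, Matrix.GeneralLinearGroup.scalar (Fin 2) t,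
        tangentStructure_scalar_mem_center _, tangentStructure_scalar_smul_eq _ _⟩
    · push Not at hu'
      obtain ⟨i, hi⟩ := ha'
      refine Or.inl fun g hg => hi ?_
      rw [smul_eq_iff_eq_inv_smul] at hg
      rw [hg]
      exact tangentStructure_fst_smul_eq_zero g⁻¹ hu' i
  · push Not at ha'
    refine ⟨_, (tangentStructure_card_repsB_le K).trans ?_, fun u => ?_⟩
    · have h := Nat.le_self_pow two_ne_zero (Fintype.card K)
      omega
    by_cases hu : u = 0
    · refine Or.inl fun g hg => ha ?_
      rw [hu, smul_eq_iff_eq_inv_smul] at hg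
      rw [hg, Units.smul_def, Matrix.smul_eq_mulVec, Matrix.mulVec_zero]
    by_cases hu' : ∃ i, (u i).fst ≠ 0
    · obtain ⟨i, hi⟩ := hu'
      refine Or.inl fun g hg => hi ?_
      rw [← hg]
      exact tangentStructure_fst_smul_eq_zero g ha' i
    · push Not at hu'
      obtain ⟨r, hr, t, ⟨t, rfl⟩, rfl⟩ := tangentStructure_exists_smul_eq_of_fst_eq hu hu'
      exact Or.inr ⟨r, hr, Matrix.GeneralLinearGroup.scalar (Fin 2) t,
        tangentStructure_scalar_mem_center _, tangentStructure_scalar_smul_eq _ _⟩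

/-- **Degree of a level-one irreducible character of `GL₂(K[ε])`**: an irreducible frame
character `χ(g) = ∑_u c u (g·u)` has `χ(1) ≤ 2|K|²` (a `Stab(a)`-fixed vector by
`exists_fixed_of_character_eq_sum`, then `finrank_le_card_of_cover` with
`tangentStructure_exists_cover`). [folklore] -/
theorem tangentStructure_degree_le {χ : Matrix.GeneralLinearGroup (Fin 2) (DualNumber K) → ℂ}
    (hχ : χ ∈ irrChars (Matrix.GeneralLinearGroup (Fin 2) (DualNumber K)))
    (hF : ∃ c : (Fin 2 → DualNumber K) → (Fin 2 → DualNumber K) → ℂ,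
      ∀ g : Matrix.GeneralLinearGroup (Fin 2) (DualNumber K),
        χ g = ∑ u : Fin 2 → DualNumber K,
          c u ((g : Matrix (Fin 2) (Fin 2) (DualNumber K)).mulVec u)) :
    (χ 1).re ≤ 2 * (Fintype.card K : ℝ) ^ 2 := by
  obtain ⟨V, _, _, _, ρ, hρ, rfl⟩ := hχ
  obtain ⟨c, hc⟩ := hF
  haveI := hρ
  have hsum : ∀ g : Matrix.GeneralLinearGroup (Fin 2) (DualNumber K), ρ.character g =
      ∑ u : Fin 2 → DualNumber K, c u (g • id u) := fun g => hc g
  obtain ⟨a, w, hw0, hw⟩ := LevelOneLink.exists_fixed_of_character_eq_sum ρ id c hsum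
  obtain ⟨R, hR, hcover⟩ := tangentStructure_exists_cover (K := K) a
  have h := (LevelOneLink.finrank_le_card_of_cover ρ (id a) hw0 hw R hcover).trans hR
  rw [ρ.char_one, Complex.natCast_re]
  exact_mod_cast h

end DualNumber

/-- **T1 `TangentStructure`** (registered stub `stub_tangentStructure` of line `tangent-cell`,
crux `LevelGradedCohnUmans.GradedDesignFamily`). For every finite field `K` (`q = |K|`) and the
tangent group `GL₂(K[ε])` over the dual numbers `K[ε]`: (i) the frame functions
`g ↦ ∑_u c u (g·u)` on `GL₂(K[ε])` are spanned by `≤ 5q⁶` functions (the indicators `[g·r = v]`,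
`r` one of `≤ 2q² + q + 1` unit-orbit representatives, `v ∈ K[ε]²`); (ii) every irreducible
character of `GL₂(K[ε])` which is a frame function has degree `≤ 2q²` (a stabiliser-fixed vector
and a central-scalar orbit cover, via the permutation-module lemmas of
`LevelGradedCohnUmansLevelOneLinkPermModule`). [folklore] -/
theorem stub_tangentStructure :
    ∀ (K : Type) [Field K] [Fintype K] [DecidableEq K] [Fintype (DualNumber K)]
      [DecidableEq (DualNumber K)],
      (∃ B : Finset (Matrix.GeneralLinearGroup (Fin 2) (DualNumber K) → ℂ),
          B.card ≤ 5 * Fintype.card K ^ 6 ∧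
          ∀ c : (Fin 2 → DualNumber K) → (Fin 2 → DualNumber K) → ℂ,
            (fun g : Matrix.GeneralLinearGroup (Fin 2) (DualNumber K) =>
                ∑ u : Fin 2 → DualNumber K,
                  c u ((g : Matrix (Fin 2) (Fin 2) (DualNumber K)).mulVec u)) ∈
              Submodule.span ℂ (B : Set (Matrix.GeneralLinearGroup (Fin 2) (DualNumber K) → ℂ))) ∧
      ∀ χ ∈ Literature.RepresentationTheory.FiniteGroups.irrChars
          (Matrix.GeneralLinearGroup (Fin 2) (DualNumber K)),
        (∃ c : (Fin 2 → DualNumber K) → (Fin 2 → DualNumber K) → ℂ,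
            ∀ g : Matrix.GeneralLinearGroup (Fin 2) (DualNumber K),
              χ g = ∑ u : Fin 2 → DualNumber K,
                c u ((g : Matrix (Fin 2) (Fin 2) (DualNumber K)).mulVec u)) →
          (χ 1).re ≤ 2 * (Fintype.card K : ℝ) ^ 2 := by
  intro K _ _ _ _ _
  exact ⟨tangentStructure_exists_spanning K, fun χ hχ hF => tangentStructure_degree_le hχ hF⟩

end Summit.MatrixMultiplication.MatrixMultiplication.Theorems.GradedDesignFamily

end
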